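import Literature.NumberTheory.LFunctions.ConeWeylSums
import Literature.NumberTheory.Sieve.MaynardNFAssembly
import HarnessLib

/-!
# Mitsui's prime number theorem for the cube boxes of a totally real field: `PrimesAsymptotic K`

Topic `Literature/NumberTheory/Sieve`. For a totally real number field `K` of degree `d` let
`P(N)` be the number of totally positive prime elements `π ∈ 𝓞 K` all of whose conjugates are
`≤ N`, i.e. the primes of the box `A₀(N)` of Castillo–Hall–Lemke Oliver–Pollack–Thompson (§2.1).
We PROVE

* `tendsto_primeCount` — **`P(N) log(N^d)/N^d → w_K/(2^d h_K R_K)`** (Mitsui's generalized prime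
  number theorem [Mitsui 1956] for these boxes, with the constant in the form of Castillo et al.,
  p. 11), and hence
* `primesAsymptotic` — `MaynardNF.PrimesAsymptotic K`:
  `|P(N)| ∼ (w_K/(2^{d} h_K R_K)) (1 − 2^{−d}) (2N)^d / log((2N)^d)` for the boxes
  `A(N) = A₀(2N) ∖ A₀(N)`.

Proof (Hecke 1920 §7 / Mitsui 1956, organised around an "anchor"): write `P(N)` and `|A₀(N)|` as
box counts `MitsuiSum.boxCount` over the primes resp. the ideals of `P⁺` (the ideals with a totally
positive generator) — an ideal `𝔞 = (β) ∈ P⁺` of norm `m ≤ N^d` has exactly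
`#{ℓ ∈ L⁺ : logMap(ι β) + ℓ ∈ s · T}` totally positive generators in `A₀(N)`, where `L⁺` is the
lattice of logarithms of the totally positive units, `T` the box in logarithmic coordinates
(`logBox`) and `s = log(N^d/m)/d` (`card_fiber`). Both families are equidistributed modulo `L⁺`
(`HeckeCone.equidistributed_primes`, `HeckeCone.equidistributed_ideals`), so by the sandwich
theorem `MitsuiSum.tendsto_of_tendsto` the two normalised box counts have the same limit; the
limit of the ideal count is known from `|A₀(N)| = N^d/√|D_K| + O(N^{d−1})`
(`CastilloEtAl2015.abs_card_box₀_sub_le`), and the class number formula (Mathlib's ideal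
density) turns `1/(ρ_K √|D_K|)` into `w_K/(2^d h_K R_K)`.

## References

* T. Mitsui, *Generalized prime number theorem*, Jap. J. Math. 26 (1956), 1–42. [cite: Mitsui1956, Main Theorem]
* E. Hecke, *Eine neue Art von Zetafunktionen …* II, Math. Z. 6 (1920), 11–51, §7. [HeckeMathZ1920]
* A. Castillo, C. Hall, R. J. Lemke Oliver, P. Pollack, L. Thompson, *Bounded gaps between primes
  in number fields and function fields*, Proc. AMS 143 (2015), §2.1, proof of Cor. 2.6.
  [cite: CastilloEtAl2015, proof of Corollary 2.6]
-/

noncomputable section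

open Filter NumberField NumberField.InfinitePlace NumberField.mixedEmbedding NumberField.Units
  NumberField.Units.dirichletUnitTheorem IsDedekindDomain Finset Topology Module Bornology
open Literature.Algebra.EuclideanLattices Literature.Algebra.EuclideanLattices.LatticePeriodic
  Literature.Algebra.EuclideanLattices.MitsuiSum
open Literature.NumberTheory.LFunctions.HeckeCone Literature.NumberTheory.Sieve.CastilloEtAl2015
open Literature.NumberTheory.LFunctions (posUnits)
open Literature.NumberTheory.LFunctions.NumberField (mem_idealsOfNorm IsTotPos)

open scoped Classical Real Pointwise

namespace Literature.NumberTheory.Sieve.MitsuiPNT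

variable {K : Type*} [Field K] [NumberField K]

/-! ## The box in logarithmic coordinates -/

variable (K) in
/-- **The box `T` in logarithmic coordinates**: `z_w ≤ 1` for `w ≠ w₀` and `−∑_{w ≠ w₀} z_w ≤ 1`
(the condition at `w₀`). [cite: Mitsui1956, §3] -/
def logBox : Set (logSpace K) := {z | (∀ w, z w ≤ 1) ∧ -∑ w, z w ≤ 1}

/-- `0 ∈ T`. [folklore] -/
theorem zero_mem_logBox : (0 : logSpace K) ∈ logBox K := by
  refine ⟨fun w ↦ by simp, by simp⟩

/-- `T` is convex. [folklore] -/
theorem convex_logBox : Convex ℝ (logBox K) := by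
  intro z hz z' hz' a b ha hb hab
  refine ⟨fun w ↦ ?_, ?_⟩
  · simp only [Pi.add_apply, Pi.smul_apply, smul_eq_mul]
    nlinarith [hz.1 w, hz'.1 w]
  · simp only [Pi.add_apply, Pi.smul_apply, smul_eq_mul, Finset.sum_add_distrib, ← Finset.mul_sum]
    nlinarith [hz.2, hz'.2]

/-- `T` is closed. [folklore] -/
theorem isClosed_logBox : IsClosed (logBox K) := by
  have h1 : IsClosed {z : logSpace K | ∀ w, z w ≤ 1} := by
    rw [Set.setOf_forall]
    exact isClosed_iInter fun w ↦ isClosed_le (continuous_apply w) continuous_const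
  have h2 : IsClosed {z : logSpace K | -∑ w, z w ≤ 1} :=
    isClosed_le ((continuous_finsetSum _ fun w _ ↦ continuous_apply w).neg) continuous_const
  exact h1.inter h2

/-- Coordinates of points of `T` are bounded below. [folklore] -/
theorem neg_le_of_mem_logBox {z : logSpace K} (hz : z ∈ logBox K) (w : {w : InfinitePlace K // w ≠ w₀}) :
    -(Fintype.card {w : InfinitePlace K // w ≠ w₀} : ℝ) ≤ z w := by
  have h1 := hz.2
  have h2 : ∑ w' ∈ (Finset.univ : Finset {w : InfinitePlace K // w ≠ w₀}).erase w, z w' ≤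
      ((Finset.univ : Finset {w : InfinitePlace K // w ≠ w₀}).erase w).card := by
    have := Finset.sum_le_sum (s := (Finset.univ : Finset {w : InfinitePlace K // w ≠ w₀}).erase w)
      (f := z) (g := fun _ ↦ (1 : ℝ)) fun w' _ ↦ hz.1 w'
    rwa [Finset.sum_const, nsmul_eq_mul, mul_one] at this
  have h3 := Finset.add_sum_erase Finset.univ z (Finset.mem_univ w)
  have h4 : (((Finset.univ : Finset {w : InfinitePlace K // w ≠ w₀}).erase w).card : ℝ) =
      Fintype.card {w : InfinitePlace K // w ≠ w₀} - 1 := by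
    rw [Finset.card_erase_of_mem (Finset.mem_univ w), Finset.card_univ, Nat.cast_sub, Nat.cast_one]
    exact Fintype.card_pos_iff.2 ⟨w⟩
  linarith

/-- `T` is bounded. [folklore] -/
theorem isBounded_logBox : IsBounded (logBox K) := by
  rw [isBounded_iff_forall_norm_le]
  refine ⟨(Fintype.card {w : InfinitePlace K // w ≠ w₀} : ℝ) + 1, fun z hz ↦ ?_⟩
  rw [pi_norm_le_iff_of_nonneg (by positivity)]
  intro w
  rw [Real.norm_eq_abs, abs_le]
  have := hz.1 w
  have := neg_le_of_mem_logBox hz w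
  constructor <;> linarith

/-- `T` is compact. [folklore] -/
theorem isCompact_logBox : IsCompact (logBox K) :=
  Metric.isCompact_of_isClosed_isBounded isClosed_logBox isBounded_logBox

/-- **Membership in the dilate `s T`** (`s ≥ 0`): `z_w ≤ s` for all `w` and `−∑ z_w ≤ s`. [folklore] -/
theorem mem_smul_logBox_iff {s : ℝ} (hs : 0 ≤ s) {z : logSpace K} :
    z ∈ s • logBox K ↔ (∀ w, z w ≤ s) ∧ -∑ w, z w ≤ s := by
  rcases eq_or_lt_of_le hs with h | h
  · subst h
    rw [Set.zero_smul_set ⟨0, zero_mem_logBox⟩, Set.mem_zero]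
    constructor
    · rintro rfl; simp
    · rintro ⟨h1, h2⟩
      have hle : ∀ w ∈ (Finset.univ : Finset {w : InfinitePlace K // w ≠ w₀}), z w ≤ 0 := fun w _ ↦ h1 w
      have hsum : ∑ w, z w = 0 := le_antisymm (Finset.sum_nonpos hle) (by linarith)
      funext w
      exact (Finset.sum_eq_zero_iff_of_nonpos hle).1 hsum w (Finset.mem_univ w)
  · rw [Set.mem_smul_set_iff_inv_smul_mem₀ h.ne']
    simp only [logBox, Set.mem_setOf_eq, Pi.smul_apply, smul_eq_mul, ← Finset.mul_sum]
    rw [← mul_neg, inv_mul_le_iff₀ h, mul_one]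
    refine and_congr (forall_congr' fun w ↦ ?_) Iff.rfl
    rw [inv_mul_le_iff₀ h, mul_one]

/-! ## Coordinates of a totally positive point and the logarithmic map -/

section TotallyReal

variable [IsTotallyReal K]

/-- In a totally real field every place is real. [folklore] -/
def realPlace (w : InfinitePlace K) : {w : InfinitePlace K // w.IsReal} := ⟨w, IsTotallyReal.isReal w⟩

omit [NumberField K] in
/-- `normAtPlace` of a point with positive real coordinates. [folklore] -/
theorem normAtPlace_eq_fst {x : mixedSpace K} (hx : ∀ w, 0 < x.1 w) (w : InfinitePlace K) :
    normAtPlace w x = x.1 (realPlace w) := by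
  rw [normAtPlace_apply_of_isReal (IsTotallyReal.isReal w), Real.norm_of_nonneg (hx _).le]; rfl

/-- The norm of a point with positive real coordinates is the product of the coordinates. [folklore] -/
theorem norm_eq_prod_fst {x : mixedSpace K} (hx : ∀ w, 0 < x.1 w) :
    mixedEmbedding.norm x = ∏ w : InfinitePlace K, x.1 (realPlace w) := by
  rw [mixedEmbedding.norm_apply]
  exact Finset.prod_congr rfl fun w _ ↦ by rw [IsTotallyReal.mult_eq, pow_one, normAtPlace_eq_fst hx]

/-- The deviation `e_w(x) = log x_w − (log N x)/d`, at every place. [folklore] -/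
def dev (x : mixedSpace K) (w : InfinitePlace K) : ℝ :=
  Real.log (normAtPlace w x) - Real.log (mixedEmbedding.norm x) / finrank ℚ K

/-- `logMap` is the deviation at the places `≠ w₀`. [folklore] -/
theorem logMap_eq_dev (x : mixedSpace K) (w : {w : InfinitePlace K // w ≠ w₀}) : logMap x w = dev x w.1 := by
  rw [logMap_apply, IsTotallyReal.mult_eq, Nat.cast_one, one_mul, dev, div_eq_mul_inv]

/-- The deviations sum to zero. [folklore] -/
theorem sum_dev_eq_zero {x : mixedSpace K} (hx : ∀ w, 0 < x.1 w) : ∑ w : InfinitePlace K, dev x w = 0 := by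
  unfold dev
  rw [Finset.sum_sub_distrib, Finset.sum_const, Finset.card_univ, nsmul_eq_mul, ← Real.log_prod]
  · rw [show (∏ w : InfinitePlace K, normAtPlace w x) = mixedEmbedding.norm x by
      rw [mixedEmbedding.norm_apply]
      exact Finset.prod_congr rfl fun w _ ↦ by rw [IsTotallyReal.mult_eq, pow_one]]
    rw [card_eq_nrRealPlaces_add_nrComplexPlaces, IsTotallyReal.nrComplexPlaces_eq_zero, add_zero,
      ← IsTotallyReal.finrank]
    have hd : (finrank ℚ K : ℝ) ≠ 0 := by exact_mod_cast (finrank_pos (R := ℚ) (M := K)).ne'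
    field_simp
    ring
  · intro w _
    rw [normAtPlace_eq_fst hx]
    exact (hx _).ne'

/-- The deviation at `w₀` is minus the sum of `logMap`. [folklore] -/
theorem dev_w₀_eq {x : mixedSpace K} (hx : ∀ w, 0 < x.1 w) :
    dev x w₀ = -∑ w : {w : InfinitePlace K // w ≠ w₀}, logMap x w := by
  have h := sum_dev_eq_zero hx
  rw [← Finset.add_sum_erase Finset.univ _ (Finset.mem_univ w₀)] at h
  have h2 : ∑ w ∈ (Finset.univ : Finset (InfinitePlace K)).erase w₀, dev x w =
      ∑ w : {w : InfinitePlace K // w ≠ w₀}, dev x w.1 :=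
    Finset.sum_subtype _ (fun w ↦ by simp) _
  rw [h2] at h
  simp only [logMap_eq_dev]
  linarith

/-- **The box condition in logarithmic coordinates.** For a point `x` with positive real
coordinates and norm `≤ N^d`, all coordinates are `≤ N` iff
`logMap x ∈ (log N − (log N x)/d) · T`. [cite: Mitsui1956, §3] -/
theorem forall_fst_le_iff {x : mixedSpace K} (hx : ∀ w, 0 < x.1 w) {N : ℝ} (hN : 0 < N)
    (hnorm : mixedEmbedding.norm x ≤ N ^ finrank ℚ K) :
    (∀ w, x.1 w ≤ N) ↔
      logMap x ∈ (Real.log N - Real.log (mixedEmbedding.norm x) / finrank ℚ K) • logBox K := by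
  have hnpos : 0 < mixedEmbedding.norm x := by
    rw [norm_eq_prod_fst hx]; exact Finset.prod_pos fun w _ ↦ hx _
  have hd : (0 : ℝ) < finrank ℚ K := by exact_mod_cast finrank_pos (R := ℚ) (M := K)
  set s : ℝ := Real.log N - Real.log (mixedEmbedding.norm x) / finrank ℚ K with hs
  have hs0 : 0 ≤ s := by
    rw [hs, sub_nonneg, div_le_iff₀ hd, mul_comm, ← Real.log_pow]
    exact Real.log_le_log hnpos hnorm
  rw [mem_smul_logBox_iff hs0]
  -- each coordinate condition is a condition on the deviation
  have hcoord : ∀ w : InfinitePlace K, x.1 (realPlace w) ≤ N ↔ dev x w ≤ s := by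
    intro w
    rw [dev, hs, sub_le_sub_iff_right, normAtPlace_eq_fst hx, Real.log_le_log_iff (hx _) hN]
  constructor
  · intro h
    have h' : ∀ w : InfinitePlace K, dev x w ≤ s := fun w ↦ (hcoord w).1 (h _)
    refine ⟨fun w ↦ by rw [logMap_eq_dev]; exact h' _, ?_⟩
    rw [← dev_w₀_eq hx]; exact h' _
  · rintro ⟨h1, h2⟩ w
    have hw : x.1 w = x.1 (realPlace w.1) := rfl
    rw [hw, hcoord]
    by_cases hw0 : w.1 = w₀
    · rw [hw0, dev_w₀_eq hx]; exact h2
    · have := h1 ⟨w.1, hw0⟩; rwa [logMap_eq_dev] at this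

end TotallyReal

/-! ## The generators of an ideal of `P⁺` in the box -/

section Periodize

variable {E : Type*} [NormedAddCommGroup E] [NormedSpace ℝ E] [FiniteDimensional ℝ E]
variable (L : Submodule ℤ E) [DiscreteTopology L] [IsZLattice ℝ L]

/-- The periodized indicator of a bounded set counts lattice translates: `F_S(y) = #{ℓ : y + ℓ ∈ S}`.
[folklore] -/
theorem periodize_indicator_eq_natCard {S : Set E} {R : ℝ} (hS : S ⊆ Metric.closedBall 0 R) (y : E) :
    periodize L (S.indicator fun _ ↦ (1 : ℝ)) y = Nat.card {ℓ : L // y + (ℓ : E) ∈ S} := by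
  set F : Set L := {ℓ | y + (ℓ : E) ∈ S} with hF
  have hFfin : F.Finite := by
    refine (finite_norm_le (L := L) (R + ‖y‖)).subset fun ℓ hℓ ↦ ?_
    have h := hS hℓ
    rw [Metric.mem_closedBall, dist_zero_right] at h
    show ‖(ℓ : E)‖ ≤ R + ‖y‖
    have h2 : (ℓ : E) = (y + ℓ) - y := by abel
    rw [h2]
    exact (norm_sub_le _ _).trans (by linarith)
  have hcard : Nat.card {ℓ : L // y + (ℓ : E) ∈ S} = hFfin.toFinset.card := Nat.card_eq_card_finite_toFinset hFfin
  rw [periodize, tsum_eq_sum (s := hFfin.toFinset) (fun ℓ hℓ ↦ ?_), hcard,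
    Finset.card_eq_sum_ones, Nat.cast_sum, Nat.cast_one]
  · refine Finset.sum_congr rfl fun ℓ hℓ ↦ ?_
    rw [Set.Finite.mem_toFinset] at hℓ
    exact Set.indicator_of_mem (show y + (ℓ : E) ∈ S from hℓ) _
  · rw [Set.Finite.mem_toFinset] at hℓ
    exact Set.indicator_of_notMem (show y + (ℓ : E) ∉ S from hℓ) _

end Periodize

section Fibres

variable [IsTotallyReal K]

omit [NumberField K] [IsTotallyReal K] in
/-- Points of the box are totally positive. [folklore] -/
theorem isTotPos_of_mem_box₀ {N : ℝ} {α : 𝓞 K} (h : α ∈ box₀ K N) : IsTotPos K (α : K) := fun w ↦ (h.1 w).1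

/-- Points of the box are nonzero. [folklore] -/
theorem ne_zero_of_mem_box₀ {N : ℝ} {α : 𝓞 K} (h : α ∈ box₀ K N) : α ≠ 0 := by
  rintro rfl
  obtain ⟨w⟩ : Nonempty (InfinitePlace K) := inferInstance
  have := (h.1 (realPlace w)).1
  simp at this

omit [NumberField K] [IsTotallyReal K] in
/-- Cancelling a totally positive factor. [folklore] -/
theorem isTotPos_of_mul_left {x y : K} (hxy : IsTotPos K (x * y)) (hx : IsTotPos K x) : IsTotPos K y := by
  intro w
  have h := hxy w
  rw [map_mul, Prod.fst_mul, Pi.mul_apply] at h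
  exact pos_of_mul_pos_right h (hx w).le

/-- Totally positive units cannot differ by a sign. [folklore] -/
theorem ne_neg_of_mem_posUnits {u u' : (𝓞 K)ˣ} (hu : u ∈ posUnits K) (hu' : u' ∈ posUnits K) : u ≠ -u' := by
  intro h
  obtain ⟨w⟩ : Nonempty (InfinitePlace K) := inferInstance
  have h1 := mem_posUnits_iff.1 hu (realPlace w)
  have h2 := mem_posUnits_iff.1 hu' (realPlace w)
  have : (((u : 𝓞 K)) : K) = -(((u' : 𝓞 K)) : K) := by rw [h]; push_cast; rfl
  rw [this, map_neg, Prod.fst_neg, Pi.neg_apply] at h1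
  linarith

/-- The logarithmic embedding is injective on the totally positive units. [folklore] -/
theorem logEmbedding_injOn_posUnits {u u' : (𝓞 K)ˣ} (hu : u ∈ posUnits K) (hu' : u' ∈ posUnits K)
    (h : logEmbedding K (Additive.ofMul u) = logEmbedding K (Additive.ofMul u')) : u = u' := by
  have h0 : logEmbedding K (Additive.ofMul (u / u')) = 0 := by rw [ofMul_div, map_sub, h, sub_self]
  rw [logEmbedding_eq_zero_iff] at h0
  rcases torsion_eq_one_or_neg_one nrRealPlaces_pos ⟨u / u', h0⟩ with h1 | h1
  · exact div_eq_one.1 h1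
  · exfalso
    have : u = -u' := by
      have := congrArg (· * u') h1
      simpa using this
    exact ne_neg_of_mem_posUnits hu hu' this

/-- A totally real field has `d` infinite places. [folklore] -/
theorem card_infinitePlace_eq_finrank : Fintype.card (InfinitePlace K) = finrank ℚ K := by
  rw [card_eq_nrRealPlaces_add_nrComplexPlaces, IsTotallyReal.nrComplexPlaces_eq_zero, add_zero,
    IsTotallyReal.finrank]

/-- The norm of a box point is `≤ N^d`. [folklore] -/
theorem norm_le_of_mem_box₀ {N : ℝ} {α : 𝓞 K} (h : α ∈ box₀ K N) :
    mixedEmbedding.norm (mixedEmbedding K (α : K)) ≤ N ^ finrank ℚ K := by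
  rw [norm_eq_prod_fst (isTotPos_of_mem_box₀ h), ← card_infinitePlace_eq_finrank, ← Finset.card_univ,
    ← Finset.prod_const]
  exact Finset.prod_le_prod (fun w _ ↦ (h.1 _).1.le) fun w _ ↦ (h.1 _).2

omit [NumberField K] in
/-- Membership in the box, given total positivity: all coordinates `≤ N`. [folklore] -/
theorem mem_box₀_iff_of_isTotPos {N : ℝ} {α : 𝓞 K} (hpos : IsTotPos K (α : K)) :
    α ∈ box₀ K N ↔ ∀ w, (mixedEmbedding K (α : K)).1 w ≤ N := by
  haveI := LFunctions.HeckeCone.isEmpty_isComplex (K := K)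
  constructor
  · exact fun h w ↦ (h.1 w).2
  · exact fun h ↦ ⟨fun w ↦ ⟨hpos w, h w⟩, fun w ↦ (IsEmpty.false w).elim⟩

/-- **The generators `β₀ u` in the box `A₀(N)`, through the lattice `L⁺`.** For `𝔞 = (β₀) ∈ P⁺` of
norm `m ≤ N^d` and a totally positive unit `u`:
`β₀ u ∈ A₀(N) ↔ logMap(ι β₀) + log(u) ∈ (log(N^d/m)/d) · T`. [cite: Mitsui1956, §3] -/
theorem mul_unit_mem_box₀_iff {N : ℝ} (hN : 0 < N) {I : Ideal (𝓞 K)} (hI : IsPosPrincipal K I)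
    (hm : (Ideal.absNorm I : ℝ) ≤ N ^ finrank ℚ K) {u : (𝓞 K)ˣ} (hu : u ∈ posUnits K) :
    (posGen I * u : 𝓞 K) ∈ box₀ K N ↔
      logPt K I + logEmbedding K (Additive.ofMul u) ∈
        (Real.log (N ^ finrank ℚ K / Ideal.absNorm I) / finrank ℚ K) • logBox K := by
  obtain ⟨h0, hpos, heq⟩ := posGen_spec hI
  have hupos : IsTotPos K (((u : 𝓞 K)) : K) := mem_posUnits_iff.1 hu
  have hαpos : IsTotPos K (((posGen I * u : 𝓞 K)) : K) := by push_cast; exact hpos.mul hupos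
  have hI0 : I ≠ ⊥ := hI.ne_bot
  have hmpos : (0 : ℝ) < Ideal.absNorm I := by
    have : Ideal.absNorm I ≠ 0 := by rwa [Ne, Ideal.absNorm_eq_zero_iff]
    positivity
  have hd : (0 : ℝ) < finrank ℚ K := by exact_mod_cast finrank_pos (R := ℚ) (M := K)
  -- the norm of the generator
  have hnorm : mixedEmbedding.norm (mixedEmbedding K (((posGen I * u : 𝓞 K)) : K)) = Ideal.absNorm I := by
    rw [norm_mixedEmbedding_eq_absNorm, Ideal.span_singleton_mul_right_unit u.isUnit, ← heq]
  rw [mem_box₀_iff_of_isTotPos hαpos, forall_fst_le_iff hαpos hN (by rw [hnorm]; exact hm), hnorm]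
  -- the logarithmic point of the generator
  have hlog : logMap (mixedEmbedding K (((posGen I * u : 𝓞 K)) : K)) = logPt K I + logEmbedding K (Additive.ofMul u) := by
    push_cast
    rw [logMap_mixedEmbedding_mul (by exact_mod_cast h0) (by exact_mod_cast u.ne_zero), logPt, logMap_eq_logEmbedding]
  have hs : Real.log N - Real.log (Ideal.absNorm I : ℝ) / finrank ℚ K =
      Real.log (N ^ finrank ℚ K / Ideal.absNorm I) / finrank ℚ K := by
    rw [Real.log_div (pow_ne_zero _ hN.ne') hmpos.ne', Real.log_pow]
    field_simp
  rw [hlog, hs]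

/-- **The number of generators of `𝔞 ∈ P⁺` in `A₀(N)` is `F_{sT}(logPt 𝔞)`**, `s = log(N^d/N𝔞)/d`.
[cite: Mitsui1956, §3] -/
theorem card_fiber {N : ℝ} (hN : 0 < N) {I : Ideal (𝓞 K)} (hI : IsPosPrincipal K I)
    (hm : (Ideal.absNorm I : ℝ) ≤ N ^ finrank ℚ K) :
    (Nat.card {α : 𝓞 K // α ∈ box₀ K N ∧ Ideal.span {α} = I} : ℝ) =
      shapeFun (L := posUnitLattice K) ((Real.log (N ^ finrank ℚ K / Ideal.absNorm I) / finrank ℚ K) • logBox K)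
        (logPt K I) := by
  obtain ⟨h0, hpos, heq⟩ := posGen_spec hI
  set S : Set (logSpace K) := (Real.log (N ^ finrank ℚ K / Ideal.absNorm I) / finrank ℚ K) • logBox K with hSdef
  -- `S` is bounded
  have hs0 : 0 ≤ Real.log (N ^ finrank ℚ K / Ideal.absNorm I) / finrank ℚ K := by
    have hI0 : I ≠ ⊥ := hI.ne_bot
    have hmpos : (0 : ℝ) < Ideal.absNorm I := by
      have : Ideal.absNorm I ≠ 0 := by rwa [Ne, Ideal.absNorm_eq_zero_iff]
      positivity
    refine div_nonneg (Real.log_nonneg ?_) (Nat.cast_nonneg _)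
    rwa [le_div_iff₀ hmpos, one_mul]
  obtain ⟨RT, hRT⟩ := (isBounded_logBox (K := K)).subset_closedBall 0
  have hSbd : S ⊆ Metric.closedBall 0 (Real.log (N ^ finrank ℚ K / Ideal.absNorm I) / finrank ℚ K * RT) :=
    smul_subset_closedBall hRT hs0
  rw [shapeFun, periodize_indicator_eq_natCard (posUnitLattice K) hSbd]
  -- the intermediate type of totally positive units
  set U := {u : (𝓞 K)ˣ // u ∈ posUnits K ∧ (posGen I * u : 𝓞 K) ∈ box₀ K N} with hU
  -- `U ≃ {α ∈ A₀(N) : (α) = I}`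
  have e1 : Function.Bijective (fun u : U ↦ (⟨posGen I * u.1, u.2.2, by
      rw [Ideal.span_singleton_mul_right_unit u.1.isUnit, ← heq]⟩ : {α : 𝓞 K // α ∈ box₀ K N ∧ Ideal.span {α} = I})) := by
    constructor
    · intro u u' h
      have h' : posGen I * (u.1 : 𝓞 K) = posGen I * u'.1 := congrArg Subtype.val h
      exact Subtype.ext (Units.ext (mul_left_cancel₀ h0 h'))
    · rintro ⟨α, hα, hspan⟩
      have hassoc : Associated (posGen I) α := by
        rw [← Ideal.span_singleton_eq_span_singleton, ← heq, hspan]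
      obtain ⟨u, hu⟩ := hassoc
      have hupos : u ∈ posUnits K := by
        rw [mem_posUnits_iff]
        refine isTotPos_of_mul_left ?_ hpos
        have : ((posGen I : 𝓞 K) : K) * ((u : 𝓞 K) : K) = ((α : 𝓞 K) : K) := by rw [← hu]; push_cast; rfl
        rw [this]; exact isTotPos_of_mem_box₀ hα
      refine ⟨⟨u, hupos, by rw [hu]; exact hα⟩, Subtype.ext hu⟩
  -- `U ≃ {ℓ ∈ L⁺ : logPt I + ℓ ∈ S}`
  have e2 : Function.Bijective (fun u : U ↦ (⟨⟨logEmbedding K (Additive.ofMul (u.1 : (𝓞 K)ˣ)),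
      logEmbedding_mem_posUnitLattice u.2.1⟩, (mul_unit_mem_box₀_iff hN hI hm u.2.1).1 u.2.2⟩ :
        {ℓ : posUnitLattice K // logPt K I + (ℓ : logSpace K) ∈ S})) := by
    constructor
    · intro u u' h
      have h' := congrArg (fun ℓ : {ℓ : posUnitLattice K // logPt K I + (ℓ : logSpace K) ∈ S} ↦ ((ℓ.1 : logSpace K))) h
      exact Subtype.ext (logEmbedding_injOn_posUnits u.2.1 u'.2.1 h')
    · rintro ⟨⟨ℓ, hℓ⟩, hmem⟩
      obtain ⟨u, hu, rfl⟩ := exists_of_mem_posUnitLattice hℓ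
      exact ⟨⟨u, hu, (mul_unit_mem_box₀_iff hN hI hm hu).2 hmem⟩, rfl⟩
  rw [← Nat.card_eq_of_bijective _ e1, Nat.card_eq_of_bijective _ e2]

/-- A box point generates an ideal of `P⁺` of norm in `[1, N^d]`. [folklore] -/
theorem span_mem_idealFamily {N : ℝ} {α : 𝓞 K} (h : α ∈ box₀ K N) :
    IsPosPrincipal K (Ideal.span {α}) ∧ 1 ≤ Ideal.absNorm (Ideal.span {α}) ∧
      (Ideal.absNorm (Ideal.span {α}) : ℝ) ≤ N ^ finrank ℚ K := by
  have h0 := ne_zero_of_mem_box₀ h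
  refine ⟨⟨α, h0, isTotPos_of_mem_box₀ h, rfl⟩, ?_, ?_⟩
  · exact Nat.one_le_iff_ne_zero.2 (by rw [Ne, Ideal.absNorm_eq_zero_iff, Ideal.span_singleton_eq_bot]; exact h0)
  · rw [← norm_mixedEmbedding_eq_absNorm]; exact norm_le_of_mem_box₀ h

/-- **Counting the box fibrewise over the ideals of `P⁺`.** For a predicate `Q` on ideals and
`N ≥ 1`: `#{α ∈ A₀(N) : Q((α))} = ∑_{m ≤ N^d} ∑_{𝔞 ∈ P⁺, N𝔞 = m, Q 𝔞} F_{s_m T}(logPt 𝔞)`.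
[cite: Mitsui1956, §3] -/
theorem card_filter_box₀_eq (Q : Ideal (𝓞 K) → Prop) {N : ℝ} (hN : 0 < N) :
    ((((finite_box₀ (K := K) N).toFinset.filter fun α ↦ Q (Ideal.span {α})).card : ℕ) : ℝ) =
      ∑ m ∈ Icc 1 ⌊N ^ finrank ℚ K⌋₊, ∑ I ∈ (idealFamily K m).filter Q,
        shapeFun (L := posUnitLattice K) ((Real.log (N ^ finrank ℚ K / m) / finrank ℚ K) • logBox K) (logPt K I) := by
  set B : Finset (𝓞 K) := (finite_box₀ (K := K) N).toFinset.filter fun α ↦ Q (Ideal.span {α}) with hB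
  set Tgt : Finset (Ideal (𝓞 K)) := (Icc 1 ⌊N ^ finrank ℚ K⌋₊).biUnion fun m ↦ (idealFamily K m).filter Q with hTgt
  have hX0 : 0 ≤ N ^ finrank ℚ K := by positivity
  -- the generated ideal lands in the target
  have hmaps : ∀ α ∈ B, Ideal.span {α} ∈ Tgt := by
    intro α hα
    rw [hB, Finset.mem_filter, Set.Finite.mem_toFinset] at hα
    obtain ⟨hP, h1, h2⟩ := span_mem_idealFamily hα.1
    rw [hTgt, Finset.mem_biUnion]
    refine ⟨Ideal.absNorm (Ideal.span {α}), Finset.mem_Icc.2 ⟨h1, Nat.le_floor h2⟩, ?_⟩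
    rw [Finset.mem_filter, idealFamily, Finset.mem_filter, mem_idealsOfNorm]
    exact ⟨⟨rfl, hP⟩, hα.2⟩
  rw [Finset.card_eq_sum_card_fiberwise hmaps, hTgt, Finset.sum_biUnion]
  · push_cast
    refine Finset.sum_congr rfl fun m hm ↦ Finset.sum_congr rfl fun I hI ↦ ?_
    rw [Finset.mem_filter, idealFamily, Finset.mem_filter, mem_idealsOfNorm] at hI
    obtain ⟨⟨hIm, hP⟩, hQ⟩ := hI
    have hmle : (m : ℝ) ≤ N ^ finrank ℚ K := (Nat.cast_le.2 (Finset.mem_Icc.1 hm).2).trans (Nat.floor_le hX0)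
    rw [← hIm, ← card_fiber hN hP (hIm ▸ hmle)]
    -- the fibre of `I` in `B` is `{α ∈ A₀(N) : (α) = I}`
    have hfil : B.filter (fun α ↦ Ideal.span {α} = I) =
        (finite_box₀ (K := K) N).toFinset.filter (fun α ↦ Ideal.span {α} = I) := by
      rw [hB, Finset.filter_filter]
      refine Finset.filter_congr fun α _ ↦ ⟨fun h ↦ h.2, fun h ↦ ⟨by rw [h]; exact hQ, h⟩⟩
    rw [hfil]
    congr 1
    have hset : ({α : 𝓞 K | α ∈ box₀ K N ∧ Ideal.span {α} = I} : Set (𝓞 K)).Finite :=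
      (finite_box₀ N).subset fun α hα ↦ hα.1
    rw [show Nat.card {α : 𝓞 K // α ∈ box₀ K N ∧ Ideal.span {α} = I} = hset.toFinset.card from
      Nat.card_eq_card_finite_toFinset hset]
    congr 1
    ext α
    simp [Set.Finite.mem_toFinset]
  · -- fibres over different norms are disjoint
    intro m _ m' _ hne
    rw [Function.onFun, Finset.disjoint_left]
    intro I hI hI'
    rw [Finset.mem_filter, idealFamily, Finset.mem_filter, mem_idealsOfNorm] at hI hI'
    exact hne (hI.1.1.symm.trans hI'.1.1)

end Fibres

/-! ## The prime count and the ideal count as box counts -/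

section Assembly

variable [IsTotallyReal K]

variable (K) in
/-- **`P(N)`**: the number of prime elements of the box `A₀(N)` (totally positive primes with all
conjugates `≤ N`). [cite: CastilloEtAl2015, §2.1] -/
def primeCount (N : ℝ) : ℕ := ((finite_box₀ (K := K) N).toFinset.filter Prime).card

/-- **`|A₀(N)|` is the box count of the ideals of `P⁺`.** [cite: Mitsui1956, §3] -/
theorem boxCount_ideals_eq {N : ℝ} (hN : 0 < N) :
    boxCount (posUnitLattice K) (logBox K) (finrank ℚ K) (idealFamily K) (logPt K) (N ^ finrank ℚ K) =
      Nat.card (box₀ K N) := by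
  have h := card_filter_box₀_eq (K := K) (fun _ ↦ True) hN
  simp only [Finset.filter_true] at h
  rw [Nat.card_eq_card_finite_toFinset (finite_box₀ N), h, boxCount]

omit [IsTotallyReal K] in
/-- The prime ideals of `P⁺` of norm `m ≥ 1` versus the primes of `primeFamily m`. [folklore] -/
theorem sum_idealFamily_filter_isPrime {m : ℕ} (hm : m ≠ 0) (g : Ideal (𝓞 K) → ℝ) :
    ∑ I ∈ (idealFamily K m).filter Ideal.IsPrime, g I = ∑ v ∈ primeFamily K m, g v.asIdeal := by
  refine (Finset.sum_bij' (fun I hI ↦ (⟨I, (Finset.mem_filter.1 hI).2, ?_⟩ : HeightOneSpectrum (𝓞 K)))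
    (fun v _ ↦ v.asIdeal) ?_ ?_ ?_ ?_ ?_).symm.symm
  · have h := (Finset.mem_filter.1 hI).1
    rw [idealFamily, Finset.mem_filter, mem_idealsOfNorm] at h
    intro h0; rw [h0, Ideal.absNorm_bot] at h; exact hm h.1.symm
  · intro I hI
    have h := (Finset.mem_filter.1 hI).1
    rw [idealFamily, Finset.mem_filter] at h
    rw [primeFamily, Finset.mem_filter, LFunctions.mem_primesOfNorm]
    exact ⟨(mem_idealsOfNorm.1 h.1), h.2⟩
  · intro v hv
    rw [primeFamily, Finset.mem_filter, LFunctions.mem_primesOfNorm] at hv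
    rw [Finset.mem_filter, idealFamily, Finset.mem_filter, mem_idealsOfNorm]
    exact ⟨⟨hv.1, hv.2⟩, v.isPrime⟩
  · intro I _; rfl
  · intro v _; rfl
  · intro I _; rfl

/-- **`P(N)` is the box count of the primes of `P⁺`.** [cite: Mitsui1956, §3] -/
theorem boxCount_primes_eq {N : ℝ} (hN : 0 < N) :
    boxCount (posUnitLattice K) (logBox K) (finrank ℚ K) (primeFamily K) (fun v ↦ logPt K v.asIdeal)
      (N ^ finrank ℚ K) = primeCount K N := by
  have h := card_filter_box₀_eq (K := K) Ideal.IsPrime hN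
  have hfil : (finite_box₀ (K := K) N).toFinset.filter (fun α ↦ (Ideal.span {α}).IsPrime) =
      (finite_box₀ (K := K) N).toFinset.filter Prime := by
    refine Finset.filter_congr fun α hα ↦ ?_
    rw [Set.Finite.mem_toFinset] at hα
    exact Ideal.span_singleton_prime (ne_zero_of_mem_box₀ hα)
  rw [hfil] at h
  rw [primeCount, h, boxCount]
  refine Finset.sum_congr rfl fun m hm ↦ ?_
  exact (sum_idealFamily_filter_isPrime (K := K) (Nat.one_le_iff_ne_zero.1 (Finset.mem_Icc.1 hm).1)
    (fun I ↦ shapeFun (L := posUnitLattice K) ((Real.log (N ^ finrank ℚ K / m) / finrank ℚ K) • logBox K) (logPt K I))).symm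

/-- **The ideal box count is `∼ X/√|D_K|`** (`|A₀(N)| = N^d/√|D| + O(N^{d−1})` with `X = N^d`).
[cite: CastilloEtAl2015, §2.3 (|A₀(N)| ∼ (2π)^{r₂}N^d/√|D|)] -/
theorem tendsto_boxCount_ideals_div :
    Tendsto (fun X : ℝ ↦ boxCount (posUnitLattice K) (logBox K) (finrank ℚ K) (idealFamily K) (logPt K) X / X)
      atTop (𝓝 (1 / Real.sqrt |(discr K : ℝ)|)) := by
  obtain ⟨C, hC⟩ := abs_card_box₀_sub_le (K := K)
  set D : ℝ := Real.sqrt |(discr K : ℝ)| with hDdef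
  have hd : (0 : ℝ) < finrank ℚ K := by exact_mod_cast finrank_pos (R := ℚ) (M := K)
  have hdinv : 0 < 1 / (finrank ℚ K : ℝ) := by positivity
  have hmajor : Tendsto (fun X : ℝ ↦ |C| * X ^ (-(1 / (finrank ℚ K : ℝ)))) atTop (𝓝 0) := by
    have := (tendsto_rpow_neg_atTop hdinv).const_mul |C|
    rwa [mul_zero] at this
  rw [Metric.tendsto_nhds]
  intro ε hε
  have hev := (Metric.tendsto_nhds.1 hmajor) ε hε
  filter_upwards [hev, eventually_ge_atTop (1 : ℝ)] with X hX hX1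
  have hX0 : 0 < X := by linarith
  -- `N = X^{1/d}`
  set N : ℝ := X ^ (1 / (finrank ℚ K : ℝ)) with hNdef
  have hN1 : 1 ≤ N := Real.one_le_rpow hX1 hdinv.le
  have hN0 : 0 < N := by linarith
  have hNX : N ^ finrank ℚ K = X := by
    rw [hNdef, ← Real.rpow_natCast, ← Real.rpow_mul hX0.le, one_div_mul_cancel hd.ne', Real.rpow_one]
  have hbox := boxCount_ideals_eq (K := K) hN0
  rw [hNX] at hbox
  rw [hbox, Real.dist_eq]
  rw [Real.dist_eq, sub_zero] at hX
  have h := hC N hN1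
  rw [hNX] at h
  have hNd : N ^ (finrank ℚ K - 1) = X / N := by
    rw [← hNX, eq_div_iff hN0.ne', ← pow_succ, Nat.sub_add_cancel finrank_pos]
  rw [hNd] at h
  have hXN : X ^ (-(1 / (finrank ℚ K : ℝ))) = N⁻¹ := by rw [hNdef, Real.rpow_neg hX0.le]
  rw [hXN] at hX
  have hD0 : 0 < D := Real.sqrt_pos.2 (abs_pos.2 (Int.cast_ne_zero.2 (discr_ne_zero K)))
  have hrew : (Nat.card (box₀ K N) : ℝ) / X - 1 / D = ((Nat.card (box₀ K N) : ℝ) - X / D) / X := by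
    field_simp
  calc |(Nat.card (box₀ K N) : ℝ) / X - 1 / D|
      = |(Nat.card (box₀ K N) : ℝ) - X / D| / X := by rw [hrew, abs_div, abs_of_pos hX0]
    _ ≤ C * (X / N) / X := div_le_div_of_nonneg_right h hX0.le
    _ = C * N⁻¹ := by field_simp
    _ ≤ |C| * N⁻¹ := mul_le_mul_of_nonneg_right (le_abs_self C) (inv_nonneg.2 hN0.le)
    _ < ε := lt_of_abs_lt hX

/-- **Mitsui's prime number theorem for the boxes `A₀(N)` of a totally real field**:
`P(N) log(N^d)/N^d → w_K/(2^d h_K R_K)`. [cite: Mitsui1956, Main Theorem] -/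
theorem tendsto_primeCount :
    Tendsto (fun N : ℝ ↦ (primeCount K N : ℝ) * Real.log (N ^ finrank ℚ K) / N ^ finrank ℚ K) atTop
      (𝓝 (torsionOrder K / (2 ^ finrank ℚ K * classNumber K * regulator K))) := by
  -- the two densities
  have hh : (0 : ℝ) < Nat.card (NCl K) := by exact_mod_cast card_NCl_pos
  have hD : 0 < Real.sqrt |(discr K : ℝ)| := Real.sqrt_pos.2 (abs_pos.2 (Int.cast_ne_zero.2 (discr_ne_zero K)))
  have hR := regulator_pos K
  have hw : (0 : ℝ) < torsionOrder K := by exact_mod_cast torsionOrder_pos K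
  have hcl : (0 : ℝ) < classNumber K := by exact_mod_cast classNumber_pos K
  have hρ : 0 < dedekindZeta_residue K := dedekindZeta_residue_pos K
  set c₁ : ℝ := 1 / Nat.card (NCl K) with hc₁
  set c₂ : ℝ := dedekindZeta_residue K / Nat.card (NCl K) with hc₂
  have hc₁0 : 0 < c₁ := by positivity
  have hc₂0 : 0 < c₂ := by positivity
  have hd : (0 : ℝ) < finrank ℚ K := by exact_mod_cast finrank_pos (R := ℚ) (M := K)
  -- the ideal box count, normalised
  have hA : Tendsto (fun X : ℝ ↦ boxCount (posUnitLattice K) (logBox K) (finrank ℚ K) (idealFamily K) (logPt K) X *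
      ((Real.log X) ^ 0 / (c₂ * X))) atTop (𝓝 ((1 / Real.sqrt |(discr K : ℝ)|) / c₂)) := by
    have := (tendsto_boxCount_ideals_div (K := K)).div_const c₂
    refine this.congr fun X ↦ ?_
    rw [pow_zero]; ring
  -- transfer to the primes
  have hT := tendsto_of_tendsto (L := posUnitLattice K) (μ := MeasureTheory.volume) convex_logBox isCompact_logBox
    zero_mem_logBox hd (le_refl 1) hc₁0 zero_le_one hc₂0 equidistributed_primes equidistributed_ideals hA
  -- along `X = N^d`
  have hpow : Tendsto (fun N : ℝ ↦ N ^ finrank ℚ K) atTop atTop := tendsto_pow_atTop finrank_pos.ne'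
  have h2 := hT.comp hpow
  have h3 : Tendsto (fun N : ℝ ↦ (primeCount K N : ℝ) * ((Real.log (N ^ finrank ℚ K)) ^ 1 / (c₁ * N ^ finrank ℚ K)))
      atTop (𝓝 ((1 / Real.sqrt |(discr K : ℝ)|) / c₂)) := by
    refine h2.congr' ?_
    filter_upwards [eventually_gt_atTop (0 : ℝ)] with N hN
    simp only [Function.comp_apply]
    rw [boxCount_primes_eq hN]
  have h4 := h3.const_mul c₁
  have hlim : c₁ * ((1 / Real.sqrt |(discr K : ℝ)|) / c₂) = torsionOrder K / (2 ^ finrank ℚ K * classNumber K * regulator K) := by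
    rw [hc₁, hc₂, dedekindZeta_residue_def, IsTotallyReal.nrComplexPlaces_eq_zero, pow_zero, mul_one,
      ← IsTotallyReal.finrank]
    field_simp
  rw [hlim] at h4
  refine h4.congr' ?_
  filter_upwards [eventually_gt_atTop (0 : ℝ)] with N hN
  rw [pow_one]
  field_simp

omit [IsTotallyReal K] in
/-- `|P(N)|` for the boxes `A(N) = A₀(2N) ∖ A₀(N)` is `P(2N) − P(N)`. [cite: CastilloEtAl2015, §2.1] -/
theorem primesA_eq {N : ℝ} (hN : 0 ≤ N) : (MaynardNF.primesA K N : ℝ) = primeCount K (2 * N) - primeCount K N := by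
  have hsub : (finite_box₀ (K := K) N).toFinset.filter Prime ⊆ (finite_box₀ (K := K) (2 * N)).toFinset.filter Prime := by
    intro α hα
    rw [Finset.mem_filter, Set.Finite.mem_toFinset] at hα ⊢
    exact ⟨box₀_mono (by linarith) hα.1, hα.2⟩
  have heq : (MaynardNF.regionF K N).filter (fun x ↦ Prime x) =
      (finite_box₀ (K := K) (2 * N)).toFinset.filter Prime \ (finite_box₀ (K := K) N).toFinset.filter Prime := by
    ext α
    rw [Finset.mem_filter, MaynardNF.mem_regionF, Finset.mem_sdiff, Finset.mem_filter, Finset.mem_filter,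
      Set.Finite.mem_toFinset, Set.Finite.mem_toFinset, CastilloEtAl2015.box, Set.mem_sdiff]
    tauto
  rw [MaynardNF.primesA, heq, Finset.card_sdiff_of_subset hsub, Nat.cast_sub (Finset.card_le_card hsub), primeCount,
    primeCount]

/-- **`PrimesAsymptotic K` for totally real `K`** (Mitsui's theorem for the boxes of Castillo et al.:
`|P(N)| ∼ (w_K/(2^d h_K R_K))(1 − 2^{−d})(2N)^d/log((2N)^d)`).
[cite: CastilloEtAl2015, proof of Corollary 2.6 (|P(N)| ∼ …, Mitsui 1956)] -/
theorem primesAsymptotic : MaynardNF.PrimesAsymptotic K := by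
  have hP := tendsto_primeCount (K := K)
  unfold MaynardNF.PrimesAsymptotic
  set κ₀ : ℝ := torsionOrder K / (2 ^ finrank ℚ K * classNumber K * regulator K) with hκ₀
  set d : ℕ := finrank ℚ K with hd
  have hd0 : d ≠ 0 := finrank_pos.ne'
  -- the term at `2N`
  have h1 : Tendsto (fun N : ℝ ↦ (primeCount K (2 * N) : ℝ) * Real.log ((2 * N) ^ d) / (2 * N) ^ d) atTop (𝓝 κ₀) :=
    hP.comp (tendsto_id.const_mul_atTop two_pos)
  -- the term at `N`, with the weight at `2N`
  have hratio : Tendsto (fun N : ℝ ↦ Real.log ((2 * N) ^ d) / Real.log (N ^ d)) atTop (𝓝 1) := by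
    have h0 : Tendsto (fun N : ℝ ↦ Real.log 2 / Real.log N) atTop (𝓝 0) := tendsto_const_nhds.div_atTop Real.tendsto_log_atTop
    have h2 : Tendsto (fun N : ℝ ↦ 1 + Real.log 2 / Real.log N) atTop (𝓝 (1 + 0)) := tendsto_const_nhds.add h0
    rw [add_zero] at h2
    refine h2.congr' ?_
    filter_upwards [eventually_gt_atTop (1 : ℝ)] with N hN
    have hlog : 0 < Real.log N := Real.log_pos hN
    rw [Real.log_pow, Real.log_pow, Real.log_mul two_ne_zero (by linarith)]
    have hdR : (d : ℝ) ≠ 0 := by exact_mod_cast hd0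
    field_simp
    ring
  have h2 : Tendsto (fun N : ℝ ↦ (primeCount K N : ℝ) * Real.log ((2 * N) ^ d) / (2 * N) ^ d) atTop (𝓝 (κ₀ * 1 * (2⁻¹ ^ d))) := by
    have := (hP.mul hratio).mul_const ((2 : ℝ)⁻¹ ^ d)
    refine this.congr' ?_
    filter_upwards [eventually_gt_atTop (1 : ℝ)] with N hN
    have hlog : Real.log (N ^ d) ≠ 0 := by
      rw [Real.log_pow]; exact mul_ne_zero (by exact_mod_cast hd0) (Real.log_pos hN).ne'
    have hN0 : (N : ℝ) ≠ 0 := by linarith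
    rw [mul_pow, inv_pow]
    field_simp
  have h3 := h1.sub h2
  rw [mul_one, ← mul_one_sub] at h3
  refine h3.congr' ?_
  filter_upwards [eventually_ge_atTop (0 : ℝ)] with N hN
  rw [primesA_eq hN]
  ring

end Assembly

/-! ## Theorem 1.1 for totally real fields, conditionally on Hinz's theorem only -/

/-- **Castillo–Hall–Lemke Oliver–Pollack–Thompson, Theorem 1.1, for totally real fields, from
Hinz's Bombieri–Vinogradov theorem alone**: the second analytic input of the paper (Mitsui's
prime number theorem for the boxes, `PrimesAsymptotic`) is now PROVED (`primesAsymptotic`), so the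
conditional `MaynardNF.castillo_of_hinz_mitsui` needs only the level of distribution
`θ < 1/2` of the primes in the boxes [Hinz 1988, main theorem].
[cite: CastilloEtAl2015, Theorem 1.1 and proof of Corollary 2.6] -/
theorem castillo_of_hinz
    (hHinz : ∀ (K : Type) [Field K] [NumberField K] [IsTotallyReal K],
      ∀ θ : ℝ, 0 < θ → θ < 1 / 2 → MaynardNF.PrimesHaveLevel K θ) :
    castilloEtAl2015_thm_1_1_totallyReal :=
  MaynardNF.castillo_of_hinz_mitsui fun K _ _ _ ↦ ⟨hHinz K, primesAsymptotic⟩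


end Literature.NumberTheory.Sieve.MitsuiPNT

end
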